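import Literature.Geometry.Manifold.LipschitzMollifierJacobian
import Literature.Geometry.Manifold.PatchSystem
import Literature.Analysis.PDE.QuasilinearCharts
import HarnessLib

/-!
# Kondo–Tanaka smoothing of a Lipschitz map on a compact manifold by a patch system

Topic `Geometry/Manifold`; namespace `Literature.Geometry.Manifold`. Third proof layer under the
named fact `Literature.Geometry.Manifold.KondoTanakaRecognition` (Kondo–Tanaka 2017, Cor. 1.10):
the global smoothing of Kondo–Tanaka §2.2 (Definition 2.15 and (2.17)), with the chart-based local
mollification of a tree `PatchSystem` in place of the exponential map. Given a patch system `P` on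
a compact boundaryless manifold `M` (framed charts `κₚ`, radii `rₚ`, partition of unity `ρₚ`
supported where `κₚ ∈ B(0, 2rₚ)`) and, for each patch, a globally Lipschitz map `gₚ : E → V`
into a finite-dimensional space `V` (in the application: a Lipschitz extension of
`F ∘ κₚ⁻¹` from `B̄(0, 4rₚ)`, `F = e ∘ h`), the smoothed map is

  `F_ε x = Σₚ ρₚ x • (J_ε gₚ)(κₚ x)`   (`J_ε` = `Literature.Analysis.Convolution.mollify`).

* `rho_smul_eq_inv_bumpSum_smul_globalize` — the `globalize` form of each term;
* `contMDiff_patchSmooth` — **`F_ε` is `C^∞`** (K–T: "we define a global approximation `F_ε`");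
* `norm_patchSmooth_sub_le` — **K–T Lemma 2.17**: `‖F_ε x − F x‖ ≤ 2ε Σₚ Lₚ` whenever
  `gₚ = F ∘ κₚ⁻¹` on `B(0, 3rₚ)`;
* `hasFDerivAt_rho_smul_mollify_transition` — the derivative of one term read in a chart `κ_q`
  (product and chain rule on the overlap, locally zero off it);
* `exists_hasFDerivAt_patchSmooth_comp_inv` — **K–T (2.20)**: in the chart `κ_q`, on
  `B̄(0, 3r_q)`, `D(F_ε ∘ κ_q⁻¹)(u) = A + Σₚ ρₚ • D(J_ε gₚ)(τ_{qp} u) ∘ Dτ_{qp}(u)` with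
  `‖A‖ ≤ C ε` (`τ_{qp}` the transition map; the first sum of (2.20),
  `Σ (dφᵢ)(F_ε^{(pᵢ)} − F)`, is `O(ε)` by Lemma 2.16 because `Σ dφᵢ = 0`).

Everything here is proved; no definitions, no named facts.

## References

* K. Kondo, M. Tanaka, *Approximations of Lipschitz maps via immersions and differentiable exotic
  sphere theorems*, Nonlinear Anal. 155 (2017) 219–249 (arXiv:1408.6036), Def. 2.15, Lemmas 2.16,
  2.17, 2.20 and (2.20). [KondoTanaka2017]
* J. M. Lee, *Introduction to Smooth Manifolds*, 2nd ed. (2013), Thm. 2.23 (partitions of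
  unity). [Lee2013]
-/

noncomputable section

open scoped Manifold ContDiff Topology NNReal
open Set Function Filter Metric
open Literature.Analysis.Convolution

namespace Literature.Geometry.Manifold

variable {E : Type*} [NormedAddCommGroup E] [InnerProductSpace ℝ E] [FiniteDimensional ℝ E]
  {H : Type*} [TopologicalSpace H] {I : ModelWithCorners ℝ E H}
  {M : Type*} [TopologicalSpace M] [ChartedSpace H M]
  {V : Type*} [NormedAddCommGroup V] [NormedSpace ℝ V]
  {ι : Type*} [Fintype ι]

namespace PatchSystem

section General

variable (P : PatchSystem I M E ι)

/-! ### The terms of the smoothed map -/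

/-- The `globalize` form of one term of the smoothed map:
`ρₚ x • m (κₚ x) = (Σ bumps)⁻¹ • globalizeₚ (bumpₚ • m) x`. [folklore] -/
theorem rho_smul_eq_inv_bumpSum_smul_globalize (p : ι) (m : E → V) (x : M) :
    P.rho p x • m ((P.chart p).map x) =
      (P.bumpSum x)⁻¹ • (P.chart p).globalize (fun y => P.bump p y • m y) x := by
  by_cases hx : x ∈ (P.chart p).source
  · rw [FramedChart.globalize_of_mem _ hx, rho, bumpM, FramedChart.globalize_of_mem _ hx,
      smul_smul, div_eq_inv_mul]
  · rw [FramedChart.globalize_of_notMem _ hx, P.rho_eq_zero_of_notMem p hx, zero_smul, smul_zero]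

/-- `ρₚ` vanishes on a neighbourhood of every point which is not charted by `κₚ` into
`B̄(0, 2rₚ)` (the support of `ρₚ` is the compact set `κₚ⁻¹(B̄(0, 2rₚ))`). [folklore] -/
theorem rho_eventuallyEq_zero [T2Space M] (p : ι) {x : M}
    (hx : ¬ (x ∈ (P.chart p).source ∧ (P.chart p).map x ∈ closedBall (0 : E) (2 * P.r p))) :
    P.rho p =ᶠ[𝓝 x] fun _ => 0 := by
  obtain ⟨hKc, hKs⟩ := (P.chart p).isCompact_image_inv (isCompact_closedBall (0 : E) (2 * P.r p))
    (P.closedBall_subset_target p (by norm_num))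
  have hxK : x ∉ (P.chart p).inv '' closedBall (0 : E) (2 * P.r p) := by
    rintro ⟨y, hy, rfl⟩
    have hyt : y ∈ (P.chart p).target := P.closedBall_subset_target p (by norm_num) hy
    exact hx ⟨(P.chart p).inv_mem_source hyt, by rwa [(P.chart p).map_inv hyt]⟩
  filter_upwards [hKc.isClosed.isOpen_compl.mem_nhds hxK] with x' hx'
  by_contra h
  obtain ⟨hs, hb⟩ := P.mem_of_rho_ne_zero p h
  exact hx' ⟨(P.chart p).map x', ball_subset_closedBall hb, (P.chart p).inv_map hs⟩

/-- `ρₚ` vanishes on a neighbourhood of every point outside the source of `κₚ`. [folklore] -/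
theorem rho_eventuallyEq_zero_of_notMem [T2Space M] (p : ι) {x : M} (hx : x ∉ (P.chart p).source) :
    P.rho p =ᶠ[𝓝 x] fun _ => 0 :=
  P.rho_eventuallyEq_zero p fun h => hx h.1

/-- In a chart `κ_q`, the expression `ρₚ ∘ κ_q⁻¹` vanishes near every point of the target whose
preimage lies outside the source of `κₚ`. [folklore] -/
theorem rho_comp_inv_eventuallyEq_zero [T2Space M] [I.Boundaryless] (p q : ι) {u : E}
    (hu : u ∈ (P.chart q).target)
    (hx : (P.chart q).inv u ∉ (P.chart p).source) :
    (P.rho p ∘ (P.chart q).inv) =ᶠ[𝓝 u] fun _ => 0 := by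
  have h := P.rho_eventuallyEq_zero_of_notMem p hx
  have hc : ContinuousAt (P.chart q).inv u :=
    (P.chart q).continuousOn_inv.continuousAt ((P.chart q).isOpen_target.mem_nhds hu)
  exact hc.eventually h

/-- `ρₚ ∘ κ_q⁻¹` is differentiable at the points of the target of `κ_q`. [folklore] -/
theorem hasFDerivAt_rho_comp_inv [I.Boundaryless] [IsManifold I ∞ M] [T2Space M] (p q : ι) {u : E}
    (hu : u ∈ (P.chart q).target) :
    HasFDerivAt (P.rho p ∘ (P.chart q).inv) (fderiv ℝ (P.rho p ∘ (P.chart q).inv) u) u :=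
  (((P.contDiffOn_rho_comp_inv p q).contDiffAt ((P.chart q).isOpen_target.mem_nhds hu))
    |>.differentiableAt (by simp)).hasFDerivAt

/-- `Σₚ D(ρₚ ∘ κ_q⁻¹)(u) = 0` on the target of `κ_q` (differentiate `Σₚ ρₚ = 1`). [folklore] -/
theorem sum_fderiv_rho_comp_inv [I.Boundaryless] [IsManifold I ∞ M] [T2Space M] (q : ι) {u : E}
    (hu : u ∈ (P.chart q).target) :
    ∑ p, fderiv ℝ (P.rho p ∘ (P.chart q).inv) u = 0 := by
  have h1 : HasFDerivAt (fun u' => ∑ p, (P.rho p ∘ (P.chart q).inv) u')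
      (∑ p, fderiv ℝ (P.rho p ∘ (P.chart q).inv) u) u :=
    HasFDerivAt.fun_sum fun p _ => P.hasFDerivAt_rho_comp_inv p q hu
  have h2 : HasFDerivAt (fun u' => ∑ p, (P.rho p ∘ (P.chart q).inv) u') (0 : E →L[ℝ] ℝ) u := by
    refine (hasFDerivAt_const (1 : ℝ) u).congr_of_eventuallyEq ?_
    filter_upwards [(P.chart q).isOpen_target.mem_nhds hu] with u' _
    simp only [comp_apply, P.sum_rho]
  exact h1.unique h2

/-- Where `ρₚ ∘ κ_q⁻¹` vanishes on the target, so does its derivative (a minimum of a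
non-negative smooth function). [folklore] -/
theorem fderiv_rho_comp_inv_eq_zero [I.Boundaryless] (p q : ι) {u : E} (hu : u ∈ (P.chart q).target)
    (h0 : P.rho p ((P.chart q).inv u) = 0) : fderiv ℝ (P.rho p ∘ (P.chart q).inv) u = 0 := by
  refine IsLocalMin.fderiv_eq_zero ?_
  filter_upwards [(P.chart q).isOpen_target.mem_nhds hu] with u' _
  simp only [comp_apply, h0]
  exact P.rho_nonneg p _

/-! ### Smoothness of the smoothed map -/

/-- The chart expression of one term is smooth on the target of any chart of the system
(`globalize` form and the tree's `contDiffOn_globalize_comp_inv`). [cite: Lee2013, Thm. 2.23] -/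
theorem contDiffOn_rho_smul_comp_inv [I.Boundaryless] [IsManifold I ∞ M] [T2Space M] (p q : ι)
    {m : E → V} (hm : ContDiff ℝ ∞ m) :
    ContDiffOn ℝ ∞ ((fun x => P.rho p x • m ((P.chart p).map x)) ∘ (P.chart q).inv)
      (P.chart q).target := by
  have heq : ((fun x => P.rho p x • m ((P.chart p).map x)) ∘ (P.chart q).inv) =
      fun u => ((P.bumpSum ∘ (P.chart q).inv) u)⁻¹ •
        ((P.chart p).globalize (fun y => P.bump p y • m y) ∘ (P.chart q).inv) u := by
    funext u
    simp only [comp_apply, P.rho_smul_eq_inv_bumpSum_smul_globalize]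
  rw [heq]
  refine ((P.contDiffOn_bumpSum_comp_inv q).inv fun u _ => (P.bumpSum_pos _).ne').smul ?_
  exact (P.chart p).contDiffOn_globalize_comp_inv (P.chart q)
    (((P.bump p).contDiff.smul hm).contDiffOn) (isCompact_closedBall (0 : E) (4 * P.r p))
    (P.closedBall_subset p) ((tsupport_smul_subset_left _ _).trans (by
      rw [ContDiffBump.tsupport_eq, bump_rOut]
      exact closedBall_subset_closedBall (by nlinarith [P.r_pos p])))

/-! ### The derivative of the smoothed map in a chart (Kondo–Tanaka (2.20)) -/

/-- The derivative of one term `ρₚ • (J_ε gₚ) ∘ κₚ` read in the chart `κ_q`, at a point `u` of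
the target: product and chain rule on the overlap with `κₚ` (the transition map
`τ = κₚ ∘ κ_q⁻¹` is smooth there), and the term vanishes near `u` off the overlap, where
`ρₚ ∘ κ_q⁻¹` and its derivative vanish so that the same formula holds. [cite: KondoTanaka2017, (2.20)] -/
theorem hasFDerivAt_rho_smul_mollify_transition [I.Boundaryless] [IsManifold I ∞ M] [T2Space M]
    (p q : ι) {m : E → V} (hm : ContDiff ℝ ∞ m)
    {u : E} (hu : u ∈ (P.chart q).target) :
    HasFDerivAt (fun u' => P.rho p ((P.chart q).inv u') • m ((P.chart q).transition (P.chart p) u'))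
      ((fderiv ℝ (P.rho p ∘ (P.chart q).inv) u).smulRight (m ((P.chart q).transition (P.chart p) u)) +
        P.rho p ((P.chart q).inv u) •
          ((fderiv ℝ m ((P.chart q).transition (P.chart p) u)).comp
            (fderiv ℝ ((P.chart q).transition (P.chart p)) u))) u := by
  by_cases hx : (P.chart q).inv u ∈ (P.chart p).source
  · -- on the overlap: product and chain rule
    have huo : u ∈ (P.chart q).overlap (P.chart p) := ((P.chart q).mem_overlap_iff _).2 ⟨hu, hx⟩
    have hτ : HasFDerivAt ((P.chart q).transition (P.chart p))
        (fderiv ℝ ((P.chart q).transition (P.chart p)) u) u :=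
      ((((P.chart q).contDiffOn_transition (P.chart p) (n := ∞)).contDiffAt
        (((P.chart q).isOpen_overlap (P.chart p)).mem_nhds huo)).differentiableAt (by simp)).hasFDerivAt
    have hmτ := ((hm.differentiable (by simp)) _).hasFDerivAt.comp u hτ
    have h := (P.hasFDerivAt_rho_comp_inv p q hu).smul hmτ
    rw [add_comm] at h
    exact h
  · -- off the overlap: everything vanishes near `u`
    have h0 : P.rho p ((P.chart q).inv u) = 0 := P.rho_eq_zero_of_notMem p hx
    have hev := P.rho_comp_inv_eventuallyEq_zero p q hu hx
    rw [h0, zero_smul, add_zero, P.fderiv_rho_comp_inv_eq_zero p q hu h0,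
      ContinuousLinearMap.zero_smulRight]
    refine (hasFDerivAt_const (0 : V) u).congr_of_eventuallyEq ?_
    filter_upwards [hev] with u' hu'
    simp only [comp_apply] at hu'
    rw [hu', zero_smul]

/-- A uniform bound for the derivatives of the partition functions read in a chart, on the
compact ball `B̄(0, 3r_q)`. [folklore] -/
theorem exists_bound_fderiv_rho_comp_inv [I.Boundaryless] [IsManifold I ∞ M] [T2Space M] (q : ι) :
    ∃ B : ι → ℝ, ∀ p, ∀ u ∈ closedBall (0 : E) (3 * P.r q),
      ‖fderiv ℝ (P.rho p ∘ (P.chart q).inv) u‖ ≤ B p := by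
  have h : ∀ p, ∃ B : ℝ, ∀ u ∈ closedBall (0 : E) (3 * P.r q),
      ‖fderiv ℝ (P.rho p ∘ (P.chart q).inv) u‖ ≤ B := fun p =>
    (isCompact_closedBall (0 : E) (3 * P.r q)).exists_bound_of_continuousOn
      (((P.contDiffOn_rho_comp_inv p q).continuousOn_fderiv_of_isOpen (P.chart q).isOpen_target
        (by simp)).mono (P.closedBall_subset_target q (by norm_num)))
  choose B hB using h
  exact ⟨B, hB⟩

end General

section Mollify

variable [MeasurableSpace E] [BorelSpace E] [FiniteDimensional ℝ V] (P : PatchSystem I M E ι)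

/-- **The smoothed map `F_ε = Σₚ ρₚ • (J_ε gₚ) ∘ κₚ` is `C^∞`** (Kondo–Tanaka (2.17) with chart
mollification; `gₚ` continuous suffices). [cite: KondoTanaka2017, Definition 2.15] -/
theorem contMDiff_patchSmooth [I.Boundaryless] [IsManifold I ∞ M] [T2Space M] (g : ι → E → V)
    (hg : ∀ p, Continuous (g p)) (ε : ℝ) :
    ContMDiff I 𝓘(ℝ, V) ∞ (fun x => ∑ p, P.rho p x • mollify ε (g p) ((P.chart p).map x)) := by
  intro x₀
  obtain ⟨q, hq, -⟩ := P.cover x₀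
  refine (P.chart q).contMDiffAt_of_contDiffOn_comp_inv ?_ hq
  have heq : ((fun x => ∑ p, P.rho p x • mollify ε (g p) ((P.chart p).map x)) ∘ (P.chart q).inv) =
      fun u => ∑ p, ((fun x => P.rho p x • mollify ε (g p) ((P.chart p).map x)) ∘
        (P.chart q).inv) u := by
    funext u; simp only [comp_apply]
  rw [heq]
  exact ContDiffOn.sum fun p _ => P.contDiffOn_rho_smul_comp_inv p q
    (contDiff_mollify ε (hg p).locallyIntegrable)

/-- **Kondo–Tanaka Lemma 2.17** (sup closeness): if each `gₚ` is `Lₚ`-Lipschitz and agrees with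
`F ∘ κₚ⁻¹` on `B(0, 3rₚ)`, then `‖F_ε x − F x‖ ≤ (Σₚ Lₚ) · 2ε` for every `x` and `ε > 0`
(`F = Σₚ ρₚ F` and Lemma 2.16 termwise). [cite: KondoTanaka2017, Lemma 2.17] -/
theorem norm_patchSmooth_sub_le {F : M → V} {g : ι → E → V} {L : ι → ℝ≥0}
    (hg : ∀ p, LipschitzWith (L p) (g p))
    (hgF : ∀ p, EqOn (g p) (F ∘ (P.chart p).inv) (ball 0 (3 * P.r p))) {ε : ℝ} (hε : 0 < ε)
    (x : M) :
    ‖(∑ p, P.rho p x • mollify ε (g p) ((P.chart p).map x)) - F x‖ ≤ (∑ p, (L p : ℝ)) * (2 * ε) := by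
  have hF : F x = ∑ p, P.rho p x • F x := by
    rw [← Finset.sum_smul, P.sum_rho, one_smul]
  rw [hF, ← Finset.sum_sub_distrib, Finset.sum_mul]
  refine (norm_sum_le _ _).trans (Finset.sum_le_sum fun p _ => ?_)
  rw [← smul_sub, norm_smul, Real.norm_of_nonneg (P.rho_nonneg p x)]
  by_cases h0 : P.rho p x = 0
  · rw [h0, zero_mul]; positivity
  · obtain ⟨hs, hb⟩ := P.mem_of_rho_ne_zero p h0
    have hgx : g p ((P.chart p).map x) = F x := by
      rw [hgF p (ball_subset_ball (by nlinarith [P.r_pos p]) hb), comp_apply,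
        (P.chart p).inv_map hs]
    rw [← hgx]
    exact (mul_le_mul (P.rho_le_one p x) (norm_mollify_sub_le_of_lipschitz (hg p) hε _)
      (norm_nonneg _) zero_le_one).trans (by rw [one_mul])

/-- **Kondo–Tanaka (2.20): the derivative of `F_ε` in the chart `κ_q`.** If each `gₚ` is
`Lₚ`-Lipschitz and agrees with `F ∘ κₚ⁻¹` on `B(0, 3rₚ)`, there is `C ≥ 0` such that for every
`ε > 0` and every `u ∈ B̄(0, 3r_q)`,
`D(F_ε ∘ κ_q⁻¹)(u) = A + Σₚ ρₚ(κ_q⁻¹ u) • D(J_ε gₚ)(τ_{qp} u) ∘ Dτ_{qp}(u)` with `‖A‖ ≤ C ε`: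
the remainder `A = Σₚ D(ρₚ ∘ κ_q⁻¹)(u) ⊗ ((J_ε gₚ)(κₚ x) − F x)` (using `Σₚ Dρₚ = 0`) is
`O(ε)` by Lemma 2.16. [cite: KondoTanaka2017, Lemma 2.20] -/
theorem exists_hasFDerivAt_patchSmooth_comp_inv [I.Boundaryless] [IsManifold I ∞ M] [T2Space M]
    {F : M → V} {g : ι → E → V} {L : ι → ℝ≥0}
    (hg : ∀ p, LipschitzWith (L p) (g p))
    (hgF : ∀ p, EqOn (g p) (F ∘ (P.chart p).inv) (ball 0 (3 * P.r p))) (q : ι) :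
    ∃ C : ℝ, 0 ≤ C ∧ ∀ ε : ℝ, 0 < ε → ∀ u ∈ closedBall (0 : E) (3 * P.r q),
      ∃ A : E →L[ℝ] V, ‖A‖ ≤ C * ε ∧
        HasFDerivAt ((fun x => ∑ p, P.rho p x • mollify ε (g p) ((P.chart p).map x)) ∘
            (P.chart q).inv)
          (A + ∑ p, P.rho p ((P.chart q).inv u) •
            ((fderiv ℝ (mollify ε (g p)) ((P.chart q).transition (P.chart p) u)).comp
              (fderiv ℝ ((P.chart q).transition (P.chart p)) u))) u := by
  obtain ⟨B, hB⟩ := P.exists_bound_fderiv_rho_comp_inv q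
  refine ⟨∑ p, |B p| * (2 * L p), Finset.sum_nonneg fun p _ => by positivity, fun ε hε u hu => ?_⟩
  have hut : u ∈ (P.chart q).target := P.closedBall_subset_target q (by norm_num) hu
  set x : M := (P.chart q).inv u with hx
  set τ : ι → E → E := fun p => (P.chart q).transition (P.chart p) with hτ
  set m : ι → E → V := fun p => mollify ε (g p) with hm
  have hmC : ∀ p, ContDiff ℝ ∞ (m p) := fun p => contDiff_mollify ε (hg p).continuous.locallyIntegrable
  -- the remainder
  set A : E →L[ℝ] V := ∑ p, (fderiv ℝ (P.rho p ∘ (P.chart q).inv) u).smulRight (m p (τ p u) - F x)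
    with hA
  refine ⟨A, ?_, ?_⟩
  · -- the bound `‖A‖ ≤ C ε`
    rw [Finset.sum_mul]
    refine (norm_sum_le _ _).trans (Finset.sum_le_sum fun p _ => ?_)
    rw [ContinuousLinearMap.norm_smulRight_apply]
    by_cases h0 : P.rho p x = 0
    · rw [P.fderiv_rho_comp_inv_eq_zero p q hut h0, norm_zero, zero_mul]
      positivity
    · obtain ⟨hs, hb⟩ := P.mem_of_rho_ne_zero p h0
      have hgx : g p ((P.chart p).map x) = F x := by
        rw [hgF p (ball_subset_ball (by nlinarith [P.r_pos p]) hb), comp_apply,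
          (P.chart p).inv_map hs]
      have hτu : τ p u = (P.chart p).map x := rfl
      rw [hτu, ← hgx, mul_assoc]
      exact mul_le_mul ((hB p u hu).trans (le_abs_self _))
        ((norm_mollify_sub_le_of_lipschitz (hg p) hε _).trans_eq (by ring)) (norm_nonneg _)
        (abs_nonneg _)
  · -- the derivative
    have hterm : ∀ p, HasFDerivAt (fun u' => P.rho p ((P.chart q).inv u') • m p (τ p u'))
        ((fderiv ℝ (P.rho p ∘ (P.chart q).inv) u).smulRight (m p (τ p u)) +
          P.rho p ((P.chart q).inv u) • ((fderiv ℝ (m p) (τ p u)).comp (fderiv ℝ (τ p) u))) u :=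
      fun p => P.hasFDerivAt_rho_smul_mollify_transition p q (hmC p) hut
    have hsum := HasFDerivAt.fun_sum fun p (_ : p ∈ Finset.univ) => hterm p
    have heqf : ((fun x => ∑ p, P.rho p x • mollify ε (g p) ((P.chart p).map x)) ∘ (P.chart q).inv) =
        fun u' => ∑ p, P.rho p ((P.chart q).inv u') • m p (τ p u') := by
      funext u'; simp only [comp_apply, hm, hτ, FramedChart.transition_apply]
    rw [heqf]
    convert hsum using 1
    rw [Finset.sum_add_distrib, hA]
    congr 1
    -- `Σₚ Dρ̂ₚ ⊗ mₚ(τ u) = Σₚ Dρ̂ₚ ⊗ (mₚ(τ u) − F x)` since `Σₚ Dρ̂ₚ = 0`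
    have hzero : ∑ p, (fderiv ℝ (P.rho p ∘ (P.chart q).inv) u).smulRight (F x) = 0 := by
      have h : ∑ p, (fderiv ℝ (P.rho p ∘ (P.chart q).inv) u).smulRight (F x) =
          (∑ p, fderiv ℝ (P.rho p ∘ (P.chart q).inv) u).smulRight (F x) := by
        ext w
        simp [Finset.sum_smul]
      rw [h, P.sum_fderiv_rho_comp_inv q hut, ContinuousLinearMap.zero_smulRight]
    calc ∑ p, (fderiv ℝ (P.rho p ∘ (P.chart q).inv) u).smulRight (m p (τ p u) - F x)
        = ∑ p, ((fderiv ℝ (P.rho p ∘ (P.chart q).inv) u).smulRight (m p (τ p u)) -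
            (fderiv ℝ (P.rho p ∘ (P.chart q).inv) u).smulRight (F x)) := by
          refine Finset.sum_congr rfl fun p _ => ?_
          ext v
          simp [ContinuousLinearMap.smulRight_apply, smul_sub]
      _ = ∑ p, (fderiv ℝ (P.rho p ∘ (P.chart q).inv) u).smulRight (m p (τ p u)) := by
          rw [Finset.sum_sub_distrib, hzero, sub_zero]

end Mollify

end PatchSystem

end Literature.Geometry.Manifold

end
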